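import Summits.Ventures.PackingBounds.Energy.FivePointRieszSixGramDataY
import Summits.Ventures.PackingBounds.Energy.FivePointRieszSixXData
import Summits.Ventures.PackingBounds.Energy.FivePointRieszSixXDataP
import Summits.Ventures.PackingBounds.Energy.GramCongrCheck
import HarnessLib

/-!
# The congruence `X = P (S·Y) Pᵀ` of `e3pt-sharp-n3N5s6d8-none.json`: chunk file `CongrFacts1x7` (kernel evaluation on integer data)

Framing: lottery ticket; floor = certified bounds/negative ranges. Venture `PackingBounds`, cell
`pub-packcert`, energy family E3PT (pub-packcert-energy gen 15; n = 3, d = 8 kernel route = KERNEL-D6 double data route, size-split).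

`decide +kernel` checks `xR6_{ab} = Σ_i Σ_j bR6_{ai} yR6_{ij} bR6_{bj}` (`GramData.checkCongr` for row ranges, `GramData.checkCongrCols` for column
ranges of a dense row; zero entries of `bR6` skipped); collected in `FivePointRieszSixCongrFacts`.
-/

namespace Summit.Ventures.PackingBounds.Energy.RieszSixD8

open Summit.Ventures.PackingBounds.Energy.GramData

set_option maxRecDepth 100000 in
set_option maxHeartbeats 0 in
/-- Rows 11–32 of `X = P (S·Y) Pᵀ` (kernel evaluation). -/
theorem congrR6_11_33 : checkCongr 165 11 33 bR6 yR6 xR6 = true := by decide +kernel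

end Summit.Ventures.PackingBounds.Energy.RieszSixD8
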